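import Mathlib
import Literature.Analysis.ODE.InverseSquareTrueChain
import Literature.Analysis.ODE.VolterraRecessiveInverseSquare
import Literature.Analysis.ODE.InverseSquareDominant

/-!
# True `t`-polynomial chains on `(½, ∞)` for a potential that is near-inverse-square on `[½, ∞)`

Analysis/ODE support file (everything proved). Let `W` be continuous with
`|W(x) − n(n+1)/x²| ≤ ε x^{-5/2}` for `x ≥ ½` and `ε ≤ 1/(64(n+1))`. We produce, for every
`j ≤ n/2` and parity `π ∈ {0,1}`, a continuous potential `P` with `P = W` on `[¾, ∞)` and a chain
`a_0, …, a_j` (`a_{j+1} = 0`) on `(½, ∞)`,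

  `a_i'' = P a_i + (2i+π+1)(2i+π+2) a_{i+1}`,
  `|a_i − c_i z^{2j−n−2i}| ≤ K ε z^{2j−n−2i−1/2}`, `|a_i' − c_i(2j−n−2i) z^{2j−n−2i−1}| ≤ K ε z^{…−3/2}`

(`z ≥ ½`, `c_0 = 1`, `|c_i| ≤ K`, `K = K(n, j, π)`): `exists_trueChain_half`. This is
`InverseSquareTrueChain.exists_true_chain` (which needs its data beyond `B ≥ 1`) applied to the
RESCALED and MODIFIED potential `P♯(y) = n(n+1)/y² + χ(y)(W(y/4)/16 − n(n+1)/y²)` (`χ = 0` on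
`(−∞,2]`, `= 1` on `[3,∞)`; near-inverse-square on all of `[1,∞)` with constant `2ε`), with the
recessive solution of `VolterraRecessiveInverseSquare` (`x₀ = 1`) and the dominant one of
`InverseSquareDominant` (bounds on `[2,∞)`), followed by the back-scaling
`a_i(z) = 4^{n−2j+2i} a♯_i(4z)`, `P(z) = 16 P♯(4z)`. Use: the true kernel elements of the far channel
estimate `FixedModeChannels` at unit scale (route PhotonSphereChannels,
stmt-FinalStateConjecture-10048). Folklore (Hartman, *ODE*, Ch. XI §9).
-/

noncomputable section

namespace Literature.Analysis.ODE

open Set Filter MeasureTheory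
open scoped Topology

/-- The modified rescaled tail `q♯(y) = χ(y) (W(y/4)/16 − n(n+1)/max(y,1)²)`,
`χ = min 1 (max 0 (y−2))`: continuous, `= 0` on `(−∞,2]`, and `|q♯| ≤ 2ε y^{-5/2}` on `[1,∞)` when
`W` is `ε`-close to `n(n+1)/x²` on `[½,∞)`. [folklore] -/
theorem modifiedTail_facts (n : ℕ) {W : ℝ → ℝ} (hW : Continuous W) {ε : ℝ} (hε0 : 0 ≤ ε)
    (hclose : ∀ x : ℝ, 1 / 2 ≤ x → |W x - (n : ℝ) * ((n : ℝ) + 1) / x ^ 2| ≤ ε * x ^ (-(5 : ℝ) / 2)) :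
    Continuous (fun y : ℝ => min 1 (max 0 (y - 2))
      * (W (y / 4) / 16 - (n : ℝ) * ((n : ℝ) + 1) / (max y 1) ^ 2)) ∧
    (∀ y : ℝ, y ≤ 2 → min 1 (max 0 (y - 2))
      * (W (y / 4) / 16 - (n : ℝ) * ((n : ℝ) + 1) / (max y 1) ^ 2) = 0) ∧
    (∀ y : ℝ, 1 ≤ y → |min 1 (max 0 (y - 2))
      * (W (y / 4) / 16 - (n : ℝ) * ((n : ℝ) + 1) / (max y 1) ^ 2)| ≤ 2 * ε * y ^ (-(5 : ℝ) / 2)) := by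
  refine ⟨?_, fun y hy => ?_, fun y hy => ?_⟩
  · refine (continuous_const.min (continuous_const.max (continuous_id.sub continuous_const))).mul
      (((hW.comp (continuous_id.div_const _)).div_const _).sub
        (continuous_const.div ((continuous_id.max continuous_const).pow 2) fun y => ?_))
    exact pow_ne_zero _ (lt_max_of_lt_right one_pos).ne'
  · have : max 0 (y - 2) = 0 := max_eq_left (by linarith)
    rw [this, min_eq_right (by norm_num : (0 : ℝ) ≤ 1), zero_mul]
  · have hy0 : 0 < y := by linarith
    have hχ0 : 0 ≤ min 1 (max 0 (y - 2)) := le_min zero_le_one (le_max_left _ _)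
    have hχ1 : min 1 (max 0 (y - 2)) ≤ 1 := min_le_left _ _
    rw [max_eq_left hy, abs_mul, abs_of_nonneg hχ0]
    have hy4 : (1 / 2 : ℝ) ≤ y / 4 ∨ y ≤ 2 := by
      rcases le_or_gt y 2 with h | h
      · exact Or.inr h
      · exact Or.inl (by linarith)
    rcases hy4 with h | h
    · have hc := hclose (y / 4) h
      have e1 : W (y / 4) / 16 - (n : ℝ) * ((n : ℝ) + 1) / y ^ 2
          = (W (y / 4) - (n : ℝ) * ((n : ℝ) + 1) / (y / 4) ^ 2) / 16 := by
        field_simp; ring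
      have h4 : (4 : ℝ) ^ ((5 : ℝ) / 2) = 32 := by
        rw [show (5 : ℝ) / 2 = 2 + 1 / 2 by norm_num, Real.rpow_add (by norm_num : (0 : ℝ) < 4),
          Real.rpow_two, ← Real.sqrt_eq_rpow, show (4 : ℝ) = 2 ^ 2 by norm_num,
          Real.sqrt_sq (by norm_num : (0 : ℝ) ≤ 2)]
        norm_num
      have e2 : (y / 4) ^ (-(5 : ℝ) / 2) = 32 * y ^ (-(5 : ℝ) / 2) := by
        rw [Real.div_rpow hy0.le (by norm_num : (0 : ℝ) ≤ 4),
          show (-(5 : ℝ) / 2) = -((5 : ℝ) / 2) by ring, Real.rpow_neg (by norm_num : (0 : ℝ) ≤ 4), h4,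
          Real.rpow_neg hy0.le]
        field_simp
      rw [e1, abs_div, abs_of_pos (by norm_num : (0 : ℝ) < 16)]
      rw [e2] at hc
      calc min 1 (max 0 (y - 2)) * (|W (y / 4) - (n : ℝ) * ((n : ℝ) + 1) / (y / 4) ^ 2| / 16)
          ≤ 1 * (ε * (32 * y ^ (-(5 : ℝ) / 2)) / 16) :=
            mul_le_mul hχ1 (div_le_div_of_nonneg_right hc (by norm_num)) (by positivity) zero_le_one
        _ = 2 * ε * y ^ (-(5 : ℝ) / 2) := by ring
    · have : max 0 (y - 2) = 0 := max_eq_left (by linarith)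
      rw [this, min_eq_right (by norm_num : (0 : ℝ) ≤ 1), zero_mul]
      positivity

/-- Tail integrals of the modified rescaled tail: `y |q♯ y|` is integrable on `(1,∞)` and
`∫_x^∞ y |q♯ y| dy ≤ 4 ε x^{-1/2}` for `x ≥ 1`. [folklore] -/
theorem modifiedTail_integral {q : ℝ → ℝ} (hq : Continuous q) {ε : ℝ}
    (hqb : ∀ y : ℝ, 1 ≤ y → |q y| ≤ 2 * ε * y ^ (-(5 : ℝ) / 2)) :
    IntegrableOn (fun y => y * |q y|) (Ioi 1) ∧
    ∀ x : ℝ, 1 ≤ x → IntegrableOn (fun y => y * |q y|) (Ioi x) ∧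
      ∫ y in Ioi x, y * |q y| ≤ 4 * ε * x ^ (-(1 : ℝ) / 2) := by
  have hpt : ∀ y : ℝ, 1 ≤ y → y * |q y| ≤ 2 * ε * y ^ (-(3 : ℝ) / 2) := by
    intro y hy
    have hy0 : 0 < y := by linarith
    calc y * |q y| ≤ y * (2 * ε * y ^ (-(5 : ℝ) / 2)) :=
          mul_le_mul_of_nonneg_left (hqb y hy) hy0.le
      _ = 2 * ε * (y ^ (1 : ℝ) * y ^ (-(5 : ℝ) / 2)) := by rw [Real.rpow_one]; ring
      _ = 2 * ε * y ^ (-(3 : ℝ) / 2) := by rw [← Real.rpow_add hy0]; norm_num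
  have hintx : ∀ x : ℝ, 1 ≤ x → IntegrableOn (fun y => y * |q y|) (Ioi x) := by
    intro x hx
    have hx0 : 0 < x := by linarith
    refine Integrable.mono' ((integrableOn_Ioi_rpow_of_lt (a := -(3 : ℝ) / 2) (by norm_num) hx0).const_mul
      (2 * ε))
      ((continuous_id.mul hq.abs).aestronglyMeasurable)
      ((ae_restrict_iff' measurableSet_Ioi).2 (ae_of_all _ fun y hy => ?_))
    have hy1 : (1 : ℝ) ≤ y := hx.trans (le_of_lt hy)
    rw [Real.norm_eq_abs, abs_of_nonneg (mul_nonneg (by linarith) (abs_nonneg _))]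
    exact hpt y hy1
  refine ⟨hintx 1 le_rfl, fun x hx => ⟨hintx x hx, ?_⟩⟩
  have hx0 : 0 < x := by linarith
  calc ∫ y in Ioi x, y * |q y| ≤ ∫ y in Ioi x, 2 * ε * y ^ (-(3 : ℝ) / 2) :=
        setIntegral_mono_on (hintx x hx)
          ((integrableOn_Ioi_rpow_of_lt (a := -(3 : ℝ) / 2) (by norm_num) hx0).const_mul _)
          measurableSet_Ioi fun y hy => hpt y (hx.trans (le_of_lt hy))
    _ = 2 * ε * (-x ^ (-(3 : ℝ) / 2 + 1) / (-(3 : ℝ) / 2 + 1)) := by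
        rw [integral_const_mul, integral_Ioi_rpow_of_lt (by norm_num) hx0]
    _ = 4 * ε * x ^ (-(1 : ℝ) / 2) := by norm_num; ring


/-- **The recessive solution for the modified rescaled potential.** With
`q♯ = χ (W(·/4)/16 − n(n+1)/max(·,1)²)` and `P♯ = n(n+1)/max(·,1)² + q♯` (continuous, `P♯ = W(·/4)/16`
on `[3,∞)`, `|q♯| ≤ 2ε y^{-5/2}` on `[1,∞)`), the Volterra-recessive solution `U` of `U'' = P♯ U`
(`x₀ = 1`, `ε ≤ 1/32`) satisfies `|xⁿU − 1| ≤ 12 ε x^{-1/2}` and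
`|U' + n x^{-n-1}| ≤ 8 ε x^{-1/2} x^{-n-1}` for `x > 1`. [folklore] -/
theorem exists_recessive_modified (n : ℕ) {W : ℝ → ℝ} (hW : Continuous W) {ε : ℝ} (hε0 : 0 ≤ ε)
    (hε : ε ≤ 1 / 32)
    (hclose : ∀ x : ℝ, 1 / 2 ≤ x → |W x - (n : ℝ) * ((n : ℝ) + 1) / x ^ 2| ≤ ε * x ^ (-(5 : ℝ) / 2)) :
    ∃ (Ps q U : ℝ → ℝ), Continuous Ps ∧ Continuous q ∧
      (∀ y : ℝ, 1 ≤ y → Ps y = (n : ℝ) * ((n : ℝ) + 1) / y ^ 2 + q y) ∧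
      (∀ y : ℝ, 3 ≤ y → Ps y = W (y / 4) / 16) ∧
      (∀ y : ℝ, 1 ≤ y → |q y| ≤ 2 * ε * y ^ (-(5 : ℝ) / 2)) ∧
      (∀ y : ℝ, y ≤ 2 → q y = 0) ∧
      (∀ y : ℝ, q y = min 1 (max 0 (y - 2))
        * (W (y / 4) / 16 - (n : ℝ) * ((n : ℝ) + 1) / (max y 1) ^ 2)) ∧
      (∀ y : ℝ, Ps y = (n : ℝ) * ((n : ℝ) + 1) / (max y 1) ^ 2 + q y) ∧
      IsSchrodingerSol Ps U ∧
      (∀ x : ℝ, 1 < x → |x ^ n * U x - 1| ≤ 12 * ε * x ^ (-(1 : ℝ) / 2)) ∧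
      (∀ x : ℝ, 1 < x → |deriv U x + n * x ^ (-(n : ℤ) - 1)|
        ≤ 8 * ε * x ^ (-(1 : ℝ) / 2) * x ^ (-(n : ℤ) - 1)) := by
  obtain ⟨hqc, hq2, hqb⟩ := modifiedTail_facts n hW hε0 hclose
  set q : ℝ → ℝ := fun y => min 1 (max 0 (y - 2))
    * (W (y / 4) / 16 - (n : ℝ) * ((n : ℝ) + 1) / (max y 1) ^ 2) with hqdef
  set Ps : ℝ → ℝ := fun y => (n : ℝ) * ((n : ℝ) + 1) / (max y 1) ^ 2 + q y with hPs
  have hPsc : Continuous Ps :=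
    (continuous_const.div ((continuous_id.max continuous_const).pow 2) fun y =>
      pow_ne_zero _ (lt_max_of_lt_right one_pos).ne').add hqc
  have hPs1 : ∀ y : ℝ, 1 ≤ y → Ps y = (n : ℝ) * ((n : ℝ) + 1) / y ^ 2 + q y := fun y hy => by
    simp only [hPs, max_eq_left hy]
  have hPs3 : ∀ y : ℝ, 3 ≤ y → Ps y = W (y / 4) / 16 := by
    intro y hy
    have hmax : max y 1 = y := max_eq_left (by linarith)
    have hχ : min 1 (max 0 (y - 2)) = 1 := by
      rw [max_eq_right (by linarith), min_eq_left (by linarith)]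
    simp only [hPs, hqdef, hmax, hχ, one_mul]; ring
  obtain ⟨hqi, htail⟩ := modifiedTail_integral hqc hqb
  have hQ1 : ∫ y in Ioi 1, y * |q y| ≤ 1 / 8 := by
    have h := (htail 1 le_rfl).2
    rw [Real.one_rpow, mul_one] at h
    linarith
  obtain ⟨U, hU, hU0, hU1⟩ := exists_isSchrodingerSol_recessive_inverseSquare hPsc hqc le_rfl n
    (fun x hx => hPs1 x hx) hqi hQ1
  refine ⟨Ps, q, U, hPsc, hqc, hPs1, hPs3, hqb, hq2, fun y => rfl, fun y => rfl, hU,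
    fun x hx => ?_, fun x hx => ?_⟩
  · have h := (htail x hx.le).2
    exact (hU0 x hx).trans (by linarith)
  · have h := (htail x hx.le).2
    have hx0 : 0 < x := by linarith
    have hz : 0 ≤ x ^ (-(n : ℤ) - 1) := zpow_nonneg hx0.le _
    calc |deriv U x + n * x ^ (-(n : ℤ) - 1)| ≤ 2 * (∫ y in Ioi x, y * |q y|) * x ^ (-(n : ℤ) - 1) :=
          hU1 x hx
      _ ≤ 2 * (4 * ε * x ^ (-(1 : ℝ) / 2)) * x ^ (-(n : ℤ) - 1) := by gcongr
      _ = 8 * ε * x ^ (-(1 : ℝ) / 2) * x ^ (-(n : ℤ) - 1) := by ring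

/-- Back-scaling algebra: if `4^σ 4^γ = 1` then a bound `|A − c (4z)^γ| ≤ K₂ (4z)^{γ−s}` becomes
`|4^σ A − c z^γ| ≤ K₂ 4^{−s} z^{γ−s}`. [folklore] -/
theorem backscale_abs_le {σ : ℕ} {γ s A cz K₂ z : ℝ} (hz : 0 < z)
    (h0 : (4 : ℝ) ^ σ * (4 : ℝ) ^ γ = 1) (hb : |A - cz * (4 * z) ^ γ| ≤ K₂ * (4 * z) ^ (γ - s)) :
    |(4 : ℝ) ^ σ * A - cz * z ^ γ| ≤ K₂ * (4 : ℝ) ^ (-s) * z ^ (γ - s) := by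
  have hsplit : ∀ r : ℝ, (4 * z) ^ r = (4 : ℝ) ^ r * z ^ r := fun r =>
    Real.mul_rpow (by norm_num) hz.le
  have hσ : (0 : ℝ) < (4 : ℝ) ^ σ := by positivity
  have hK₂ : 0 ≤ K₂ := by
    have h1 : 0 ≤ K₂ * (4 * z) ^ (γ - s) := (abs_nonneg _).trans hb
    have h2 : 0 < (4 * z) ^ (γ - s) := Real.rpow_pos_of_pos (by linarith) _
    nlinarith [mul_nonneg_iff_of_pos_right h2 |>.1 h1]
  have e : (4 : ℝ) ^ σ * A - cz * z ^ γ = (4 : ℝ) ^ σ * (A - cz * (4 * z) ^ γ) := by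
    rw [hsplit γ]
    calc (4 : ℝ) ^ σ * A - cz * z ^ γ
        = (4 : ℝ) ^ σ * A - cz * ((4 : ℝ) ^ σ * (4 : ℝ) ^ γ) * z ^ γ := by rw [h0]; ring
      _ = _ := by ring
  rw [e, abs_mul, abs_of_pos hσ]
  calc (4 : ℝ) ^ σ * |A - cz * (4 * z) ^ γ| ≤ (4 : ℝ) ^ σ * (K₂ * (4 * z) ^ (γ - s)) :=
        mul_le_mul_of_nonneg_left hb hσ.le
    _ = K₂ * ((4 : ℝ) ^ σ * (4 : ℝ) ^ γ * (4 : ℝ) ^ (-s)) * z ^ (γ - s) := by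
        rw [hsplit (γ - s), show γ - s = γ + -s by ring, Real.rpow_add (by norm_num : (0 : ℝ) < 4)]
        ring
    _ = K₂ * (4 : ℝ) ^ (-s) * z ^ (γ - s) := by rw [h0]; ring

/-- **True chains on `(½,∞)` for a potential near-inverse-square on `[½,∞)`.** See the module
docstring. [folklore] -/
theorem exists_trueChain_half (n j π : ℕ) (hj : 2 * j ≤ n) :
    ∃ K : ℝ, 0 ≤ K ∧ ∀ {W : ℝ → ℝ} {ε : ℝ}, Continuous W → 0 ≤ ε → ε ≤ 1 / (64 * ((n : ℝ) + 1)) →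
      (∀ x : ℝ, 1 / 2 ≤ x → |W x - (n : ℝ) * ((n : ℝ) + 1) / x ^ 2| ≤ ε * x ^ (-(5 : ℝ) / 2)) →
      ∃ (P : ℝ → ℝ) (a a' : ℕ → ℝ → ℝ) (c : ℕ → ℝ), Continuous P ∧ (∀ z, 3 / 4 ≤ z → P z = W z) ∧
        c 0 = 1 ∧ (∀ z, a (j + 1) z = 0) ∧ (∀ i, i ≤ j → Continuous (a i)) ∧
        (∀ i, i ≤ j → ∀ z, (1 / 2 : ℝ) < z → HasDerivAt (a i) (a' i z) z ∧
          HasDerivAt (a' i) (P z * a i z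
            + ((2 * i + π + 1) * (2 * i + π + 2) : ℕ) * a (i + 1) z) z) ∧
        (∀ i, i ≤ j → ∀ z, (1 / 2 : ℝ) ≤ z →
          |a i z - c i * z ^ ((2 * j : ℝ) - n - 2 * i)|
              ≤ K * ε * z ^ ((2 * j : ℝ) - n - 2 * i - 1 / 2) ∧
          |a' i z - c i * ((2 * j : ℝ) - n - 2 * i) * z ^ ((2 * j : ℝ) - n - 2 * i - 1)|
            ≤ K * ε * z ^ ((2 * j : ℝ) - n - 2 * i - 3 / 2)) ∧
        (∀ i, i ≤ j → |c i| ≤ K) := by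
  classical
  set μ : ℕ → ℝ := fun i => (((2 * i + π + 1) * (2 * i + π + 2) : ℕ) : ℝ) with hμ
  have hμ0 : ∀ i, μ i ≠ 0 := fun i => by simp only [hμ]; positivity
  obtain ⟨K, hK0, hK⟩ := exists_true_chain n hμ0 hj (cU := 3 / 2) (cU' := n + 1) (KU := 6)
    (by norm_num) (by positivity) (by norm_num)
  refine ⟨K, hK0, ?_⟩
  intro W ε hW hε0 hε hclose
  have hn0 : (0 : ℝ) ≤ n := n.cast_nonneg
  have hε64 : ε ≤ 1 / 64 :=
    hε.trans (one_div_le_one_div_of_le (by norm_num) (by nlinarith))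
  have hε32 : ε ≤ 1 / 32 := hε64.trans (by norm_num)
  obtain ⟨Ps, q, U, hPsc, hqc, hPs1, hPs3, hqb, -, -, -, hU, hU0, hU1⟩ :=
    exists_recessive_modified n hW hε0 hε32 hclose
  -- elementary conversions at `z > 1`
  have conv : ∀ z : ℝ, 1 < z →
      0 < z ∧ z ^ (-(n : ℝ)) = (z ^ n)⁻¹ ∧ z ^ (-(n : ℤ) - 1) = z ^ (-(n : ℝ) - 1) ∧
      z ^ (-(1 : ℝ) / 2) ≤ 1 ∧ 0 < z ^ n ∧ 0 ≤ z ^ (-(1 : ℝ) / 2) := by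
    intro z hz
    have hz0 : 0 < z := by linarith
    refine ⟨hz0, by rw [Real.rpow_neg hz0.le, Real.rpow_natCast], ?_, ?_, pow_pos hz0 n,
      Real.rpow_nonneg hz0.le _⟩
    · rw [← Real.rpow_intCast]; push_cast; ring_nf
    · exact Real.rpow_le_one_of_one_le_of_nonpos hz.le (by norm_num)
  -- the dominant solution
  set η : ℝ := (12 + 12 * n) * ε with hη
  have hηle : η ≤ 1 / 2 := by
    have h1 : (12 + 12 * (n : ℝ)) * ε ≤ (12 + 12 * n) * (1 / (64 * ((n : ℝ) + 1))) :=
      mul_le_mul_of_nonneg_left hε (by positivity)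
    have h2 : (12 + 12 * (n : ℝ)) * (1 / (64 * ((n : ℝ) + 1))) ≤ 1 / 2 := by
      rw [mul_one_div, div_le_iff₀ (by positivity : (0 : ℝ) < 64 * ((n : ℝ) + 1))]
      linarith
    rw [hη]; exact h1.trans h2
  have hU0' : ∀ z : ℝ, 1 < z → |z ^ n * U z - 1| ≤ η := by
    intro z hz
    obtain ⟨hz0, -, -, hzh, -, -⟩ := conv z hz
    calc |z ^ n * U z - 1| ≤ 12 * ε * z ^ (-(1 : ℝ) / 2) := hU0 z hz
      _ ≤ 12 * ε * 1 := mul_le_mul_of_nonneg_left hzh (by positivity)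
      _ ≤ η := by rw [hη]; nlinarith
  have hU1' : ∀ z : ℝ, 1 < z → |z ^ (n + 1) * deriv U z + n * (z ^ n * U z)| ≤ η := by
    intro z hz
    obtain ⟨hz0, -, -, hzh, hzn, hzh0⟩ := conv z hz
    have hzn1 : 0 < z ^ (n + 1) := pow_pos hz0 _
    have e : z ^ (n + 1) * deriv U z + n * (z ^ n * U z)
        = z ^ (n + 1) * (deriv U z + n * z ^ (-(n : ℤ) - 1)) + n * (z ^ n * U z - 1) := by
      have : z ^ (n + 1) * z ^ (-(n : ℤ) - 1) = 1 := by
        rw [← zpow_natCast, ← zpow_add₀ hz0.ne']; push_cast; ring_nf; exact zpow_zero _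
      calc z ^ (n + 1) * deriv U z + n * (z ^ n * U z)
          = z ^ (n + 1) * deriv U z + n * (z ^ (n + 1) * z ^ (-(n : ℤ) - 1)) + n * (z ^ n * U z - 1) := by
            rw [this]; ring
        _ = _ := by ring
    rw [e]
    have h1 : |z ^ (n + 1) * (deriv U z + n * z ^ (-(n : ℤ) - 1))| ≤ 8 * ε := by
      rw [abs_mul, abs_of_pos hzn1]
      calc z ^ (n + 1) * |deriv U z + n * z ^ (-(n : ℤ) - 1)|
          ≤ z ^ (n + 1) * (8 * ε * z ^ (-(1 : ℝ) / 2) * z ^ (-(n : ℤ) - 1)) :=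
            mul_le_mul_of_nonneg_left (hU1 z hz) hzn1.le
        _ = 8 * ε * z ^ (-(1 : ℝ) / 2) * (z ^ (n + 1) * z ^ (-(n : ℤ) - 1)) := by ring
        _ ≤ 8 * ε * 1 * 1 := by
            have : z ^ (n + 1) * z ^ (-(n : ℤ) - 1) = 1 := by
              rw [← zpow_natCast, ← zpow_add₀ hz0.ne']; push_cast; ring_nf; exact zpow_zero _
            rw [this]; gcongr
        _ = 8 * ε := by ring
    have h2 : |(n : ℝ) * (z ^ n * U z - 1)| ≤ n * (12 * ε) := by
      rw [abs_mul, abs_of_nonneg hn0]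
      refine mul_le_mul_of_nonneg_left ((hU0 z hz).trans ?_) hn0
      exact (mul_le_mul_of_nonneg_left hzh (by positivity)).trans (le_of_eq (mul_one _))
    calc |z ^ (n + 1) * (deriv U z + n * z ^ (-(n : ℤ) - 1)) + n * (z ^ n * U z - 1)|
        ≤ 8 * ε + n * (12 * ε) := (abs_add_le _ _).trans (add_le_add h1 h2)
      _ ≤ η := by rw [hη]; nlinarith
  obtain ⟨V, hV, hWr, hVb, hV'b⟩ := exists_dominant_of_recessive hPsc hU le_rfl hηle hU0' hU1'
  -- the hypotheses of the chain construction at `B = 2`, `ε♯ = 2ε`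
  have hUb : ∀ z : ℝ, 2 ≤ z → |U z| ≤ 3 / 2 * z ^ (-(n : ℝ)) := by
    intro z hz
    obtain ⟨hz0, hrn, -, hzh, hzn, -⟩ := conv z (by linarith)
    have h := abs_le.1 (hU0' z (by linarith))
    have hzU : z ^ n * |U z| ≤ 3 / 2 := by
      rw [← abs_of_pos hzn, ← abs_mul]; exact abs_le.2 ⟨by linarith, by linarith⟩
    rw [hrn, ← div_eq_mul_inv, le_div_iff₀ hzn, mul_comm]
    exact hzU
  have hU'b : ∀ z : ℝ, 2 ≤ z → |deriv U z| ≤ ((n : ℝ) + 1) * z ^ (-(n : ℝ) - 1) := by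
    intro z hz
    obtain ⟨hz0, -, hzr, hzh, -, hzh0⟩ := conv z (by linarith)
    have hzp : 0 ≤ z ^ (-(n : ℤ) - 1) := zpow_nonneg hz0.le _
    have h := hU1 z (by linarith)
    rw [← hzr]
    have h3 : |deriv U z| ≤ |deriv U z + n * z ^ (-(n : ℤ) - 1)| + n * z ^ (-(n : ℤ) - 1) := by
      have := abs_sub_le (deriv U z + n * z ^ (-(n : ℤ) - 1)) (n * z ^ (-(n : ℤ) - 1)) 0
      simp only [sub_zero, add_sub_cancel_right] at this
      have h' := abs_add_le (deriv U z + n * z ^ (-(n : ℤ) - 1)) (-(n * z ^ (-(n : ℤ) - 1)))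
      rw [add_neg_cancel_right, abs_neg, abs_of_nonneg (mul_nonneg hn0 hzp)] at h'
      exact h'
    calc |deriv U z| ≤ |deriv U z + n * z ^ (-(n : ℤ) - 1)| + n * z ^ (-(n : ℤ) - 1) := h3
      _ ≤ 8 * ε * z ^ (-(1 : ℝ) / 2) * z ^ (-(n : ℤ) - 1) + n * z ^ (-(n : ℤ) - 1) :=
          add_le_add h le_rfl
      _ ≤ 8 * ε * 1 * z ^ (-(n : ℤ) - 1) + n * z ^ (-(n : ℤ) - 1) := by gcongr
      _ = (8 * ε + n) * z ^ (-(n : ℤ) - 1) := by ring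
      _ ≤ ((n : ℝ) + 1) * z ^ (-(n : ℤ) - 1) := by
          refine mul_le_mul_of_nonneg_right ?_ hzp; linarith
  have hVb' : ∀ z : ℝ, 2 ≤ z → |V z| ≤ 6 * z ^ ((n : ℝ) + 1) := by
    intro z hz
    have h := hVb z (by norm_num; exact hz)
    rwa [← Real.rpow_natCast, Nat.cast_add, Nat.cast_one] at h
  have hV'b' : ∀ z : ℝ, 2 ≤ z → |deriv V z| ≤ 5 * z ^ (n : ℝ) := by
    intro z hz
    have h := hV'b z (by norm_num; exact hz)
    rwa [← Real.rpow_natCast] at h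
  have hUrec : ∀ z : ℝ, 2 ≤ z → |U z - z ^ (-(n : ℝ))| ≤ 6 * (2 * ε) * z ^ (-(n : ℝ) - 1 / 2) := by
    intro z hz
    obtain ⟨hz0, hrn, -, -, hzn, -⟩ := conv z (by linarith)
    have e : U z - z ^ (-(n : ℝ)) = (z ^ n)⁻¹ * (z ^ n * U z - 1) := by
      rw [hrn]; field_simp
    rw [e, abs_mul, abs_of_pos (inv_pos.2 hzn)]
    calc (z ^ n)⁻¹ * |z ^ n * U z - 1| ≤ (z ^ n)⁻¹ * (12 * ε * z ^ (-(1 : ℝ) / 2)) :=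
          mul_le_mul_of_nonneg_left (hU0 z (by linarith)) (inv_pos.2 hzn).le
      _ = 6 * (2 * ε) * (z ^ (-(n : ℝ)) * z ^ (-(1 : ℝ) / 2)) := by rw [hrn]; ring
      _ = 6 * (2 * ε) * z ^ (-(n : ℝ) - 1 / 2) := by
          rw [← Real.rpow_add hz0]; ring_nf
  have hU'rec : ∀ z : ℝ, 2 ≤ z →
      |deriv U z + n * z ^ (-(n : ℝ) - 1)| ≤ 6 * (2 * ε) * z ^ (-(n : ℝ) - 3 / 2) := by
    intro z hz
    obtain ⟨hz0, -, hzr, -, -, -⟩ := conv z (by linarith)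
    have h := hU1 z (by linarith)
    rw [hzr] at h
    calc |deriv U z + n * z ^ (-(n : ℝ) - 1)| ≤ 8 * ε * z ^ (-(1 : ℝ) / 2) * z ^ (-(n : ℝ) - 1) := h
      _ = 8 * ε * z ^ (-(n : ℝ) - 3 / 2) := by
          rw [mul_assoc, ← Real.rpow_add hz0]; ring_nf
      _ ≤ 6 * (2 * ε) * z ^ (-(n : ℝ) - 3 / 2) := by
          have : 0 ≤ z ^ (-(n : ℝ) - 3 / 2) := Real.rpow_nonneg hz0.le _
          nlinarith
  obtain ⟨a, a', c, hc0, htop, hcont, hder, hcl, hcK⟩ := hK hU hV hWr (B := 2) (ε := 2 * ε)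
    (by norm_num) (by positivity) hUb hU'b hVb' hV'b' hqc (fun z hz => hPs1 z (by linarith))
    (fun z hz => hqb z (by linarith)) hUrec hU'rec
  -- back-scaling `z ↦ 4z`
  have hpow4 : ∀ (i : ℕ) (r : ℝ),
      (4 : ℝ) ^ (n - 2 * j + 2 * i) * (4 : ℝ) ^ (((2 * j : ℝ) - n - 2 * i) + r) = (4 : ℝ) ^ r := by
    intro i r
    rw [← Real.rpow_natCast, ← Real.rpow_add (by norm_num : (0 : ℝ) < 4)]
    congr 1
    push_cast [Nat.cast_sub hj]
    ring
  have h4half : (4 : ℝ) ^ (-(1 : ℝ) / 2) = 1 / 2 := by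
    rw [show (-(1 : ℝ) / 2) = -((1 : ℝ) / 2) by ring, Real.rpow_neg (by norm_num),
      ← Real.sqrt_eq_rpow, show (4 : ℝ) = 2 ^ 2 by norm_num, Real.sqrt_sq (by norm_num)]
    norm_num
  refine ⟨fun z => 16 * Ps (4 * z), fun i z => (4 : ℝ) ^ (n - 2 * j + 2 * i) * a i (4 * z),
    fun i z => (4 : ℝ) ^ (n - 2 * j + 2 * i + 1) * a' i (4 * z), c,
    continuous_const.mul (hPsc.comp (continuous_const.mul continuous_id)), ?_, hc0, ?_, ?_, ?_, ?_,
    hcK⟩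
  · intro z hz
    show 16 * Ps (4 * z) = W z
    rw [hPs3 (4 * z) (by linarith)]
    rw [show 4 * z / 4 = z by ring]; ring
  · intro z; show (4 : ℝ) ^ (n - 2 * j + 2 * (j + 1)) * a (j + 1) (4 * z) = 0; rw [htop]; ring
  · intro i hi
    exact continuous_const.mul ((hcont i hi).comp (continuous_const.mul continuous_id))
  · intro i hi z hz
    have h4z : (2 : ℝ) < 4 * z := by linarith
    obtain ⟨hd1, hd2⟩ := hder i hi (4 * z) h4z
    have hlin : HasDerivAt (fun z : ℝ => 4 * z) 4 z := by
      simpa using (hasDerivAt_id z).const_mul (4 : ℝ)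
    constructor
    · have h := (hd1.comp z hlin).const_mul ((4 : ℝ) ^ (n - 2 * j + 2 * i))
      refine h.congr_deriv ?_
      simp only [pow_succ]; ring
    · have h := (hd2.comp z hlin).const_mul ((4 : ℝ) ^ (n - 2 * j + 2 * i + 1))
      refine h.congr_deriv ?_
      have e : (4 : ℝ) ^ (n - 2 * j + 2 * (i + 1)) = (4 : ℝ) ^ (n - 2 * j + 2 * i) * 16 := by
        rw [show n - 2 * j + 2 * (i + 1) = n - 2 * j + 2 * i + 2 by omega, pow_add]; norm_num
      simp only [hμ, e, pow_succ]
      ring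
  · intro i hi z hz
    have hz0 : 0 < z := by linarith
    have h4z : (2 : ℝ) ≤ 4 * z := by linarith
    obtain ⟨hc1, hc2⟩ := hcl i hi (4 * z) h4z
    have h0 := hpow4 i 0
    rw [add_zero, Real.rpow_zero] at h0
    have h0' : (4 : ℝ) ^ (n - 2 * j + 2 * i + 1) * (4 : ℝ) ^ ((2 * j : ℝ) - n - 2 * i - 1) = 1 := by
      rw [pow_succ, show (2 * j : ℝ) - n - 2 * i - 1 = ((2 * j : ℝ) - n - 2 * i) + (-1 : ℝ) by ring,
        Real.rpow_add (by norm_num : (0 : ℝ) < 4), Real.rpow_neg_one]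
      calc (4 : ℝ) ^ (n - 2 * j + 2 * i) * 4 * ((4 : ℝ) ^ ((2 * j : ℝ) - n - 2 * i) * 4⁻¹)
          = (4 : ℝ) ^ (n - 2 * j + 2 * i) * (4 : ℝ) ^ ((2 * j : ℝ) - n - 2 * i) * (4 * 4⁻¹) := by ring
        _ = 1 := by rw [h0]; norm_num
    have h4s : (4 : ℝ) ^ (-(1 / 2 : ℝ)) = 1 / 2 := by
      rw [show (-(1 / 2 : ℝ)) = -(1 : ℝ) / 2 by ring]; exact h4half
    constructor
    · have h := backscale_abs_le hz0 h0 hc1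
      rw [h4s] at h
      calc _ ≤ K * (2 * ε) * (1 / 2) * z ^ ((2 * j : ℝ) - n - 2 * i - 1 / 2) := h
        _ = K * ε * z ^ ((2 * j : ℝ) - n - 2 * i - 1 / 2) := by ring
    · rw [show (2 * j : ℝ) - n - 2 * i - 3 / 2 = (2 * j : ℝ) - n - 2 * i - 1 - 1 / 2 by ring] at hc2 ⊢
      have h := backscale_abs_le (cz := c i * ((2 * j : ℝ) - n - 2 * i)) hz0 h0' hc2
      rw [h4s] at h
      calc _ ≤ K * (2 * ε) * (1 / 2) * z ^ ((2 * j : ℝ) - n - 2 * i - 1 - 1 / 2) := h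
        _ = K * ε * z ^ ((2 * j : ℝ) - n - 2 * i - 1 - 1 / 2) := by ring

end Literature.Analysis.ODE
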